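import Summits.BirchSwinnertonDyer.BirchSwinnertonDyer.Theorems.CyclotomicUntwistUntwistingIdentity
import HarnessLib

/-!
# The untwisting identity at EVERY level `pⁿ > p^c` (the "tame" levels `p^c < pⁿ < p^{2c}` included):
# `untwistSymbolSum p f η χ = η(−1) · J_n(η, χ) · ratTwistedSymbolSum f (χ η↑)` with the character sum
# `J_n(η, χ) = ∑_{b mod p^c} η(b) χ(1 + p^{n−c} b)`

Cell `pub/bsd-wall` (D-0145 line `route-BirchSwinnertonDyer-CyclotomicUntwist`), seat `bsd-line-cycu-p1`
(prover seat 1/3, K1 base), helper toward crux K1 `PSRankOneLowerHalfAtThree`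
(stmt-BirchSwinnertonDyer-21580). THEOREMS ONLY (no definition, no named fact, no `sorry`); BSD is not
proved by this file and no crux is.

`CyclotomicUntwistUntwistingIdentity` proved (★) for `n ≥ 2c`, where `y ↦ χ(1 + p^{n−c}y)` is ADDITIVE on
`ℤ/p^c` and `J_n` is a genuine Gauss sum. The additivity is NOT needed for the identity itself: for every
`n > c ≥ 0` (`untwistSymbolSum_eq_charSum`)

  `∑_{a mod pⁿ} ∑_{b mod p^c} χ(a) η(b) [a/pⁿ + b/p^c]⁺_f = η(−1) · J_n(η,χ) · ∑_{a mod pⁿ} (χη↑)(a) [a/pⁿ]⁺_f`,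
  `J_n(η, χ) := ∑_{b mod p^c} η(b) · χ(1 + p^{n−c}·b)`

(same proof: `[a/pⁿ + b/p^c]⁺ = [(a + p^{n−c}b)/pⁿ]⁺`, re-index, and at a unit `u` the inner sum is
`χ(u) ∑_b η(b) χ(1 − p^{n−c} b ū⁻¹) = χ(u) η(−1) η(ū) J_n` after `b ↦ −ū b`; at a non-unit both sides vanish
since `n > c`). For `n ≥ 2c`, `J_n = g(η, ψ_χ)` (`charSum_eq_gaussSum`) and one recovers (★); for
`c < n < 2c` — on the route (`p = 3`, `c = 2`) the single conductor `27` — `J_n` is a Jacobi-type sum whose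
non-vanishing is NOT proved here. Consequence for D1 (`gammaCharValue_eq_charSum`): for `μ` with
`IsUntwistedPAdicLFunction p f η α μ` and `ξ` primitive even of `p`-power order and conductor `pⁿ`, `n > c`,
`c ≥ 1`: `∫_Γ ξ dμ = e_n(α) · η(−1) · J_n(η, χ) · ∑_{a mod pⁿ} ξ(a)[a/pⁿ]⁺_f` with `χ` the primitive
character of `η̄ξ`. So every interpolation value of D1 except those at conductor `≤ p^c` (route: `ξ = 𝟙`,
done by cycu-p2's `CyclotomicUntwistValueAtOne.value_at_one`, and conductor `9`) is an explicit multiple of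
the ORDINARY twisted symbol sum of `f` (Birch: `τ(ξ) L(f, ξ̄, 1)/Ω⁺_f`).

References: [cite: MazurTateTeitelbaum1986Invent, §I.8 (8.6) and §I.14 (case p ∣ N)]; [folklore].
-/

noncomputable section

open scoped MatrixGroups

open CongruenceSubgroup DirichletCharacter Literature.NumberTheory.EllipticCurves
  Literature.NumberTheory.EllipticCurves.ModularForms Literature.NumberTheory.IwasawaTheory
  Summit.BirchSwinnertonDyer.BirchSwinnertonDyer.Theorems.PSUntwisting

-- single-conjunct summit: `Summit.BirchSwinnertonDyer.BirchSwinnertonDyer.…` repeats the name by design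
set_option linter.dupNamespace false
set_option autoImplicit false

namespace Summit.BirchSwinnertonDyer.BirchSwinnertonDyer.Theorems.PSUntwistingAll

variable {p : ℕ} [Fact p.Prime]

section Identity

variable {N : ℕ} [NeZero N] (f : CuspForm (Gamma0 N) 2)
variable {c n : ℕ} (η : DirichletCharacter ℂ_[p] (p ^ c)) (χ : DirichletCharacter ℂ_[p] (p ^ n))

/-- The inner character sum at a UNIT, any `n ≥ c`: `∑_b η(b) χ(u − p^{n−c} b) = χ(u) η(−1) η(ū) J_n`
with `J_n = ∑_b η(b) χ(1 + p^{n−c} b)` and `ū = u mod p^c` (re-index `b ↦ −ū·b`; no additivity used).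
[folklore] -/
theorem inner_sum_eq_charSum_of_isUnit (hcn : c ≤ n) (u : (ZMod (p ^ n))ˣ) :
    ∑ b : ZMod (p ^ c), η b * χ ((u : ZMod (p ^ n)) - ((p ^ (n - c) : ℕ) : ZMod (p ^ n)) * ((b.val : ℕ) : ZMod (p ^ n))) =
      χ u * η (-1) * η (ZMod.castHom (pow_dvd_pow p hcn) (ZMod (p ^ c)) u) *
        ∑ b : ZMod (p ^ c), η b * χ (1 + ((p ^ (n - c) : ℕ) : ZMod (p ^ n)) * ((b.val : ℕ) : ZMod (p ^ n))) := by
  haveI : NeZero (p ^ c) := ⟨pow_ne_zero _ (Fact.out : p.Prime).ne_zero⟩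
  haveI : NeZero (p ^ n) := ⟨pow_ne_zero _ (Fact.out : p.Prime).ne_zero⟩
  set π := ZMod.castHom (pow_dvd_pow p hcn) (ZMod (p ^ c)) with hπ
  set t : ZMod (p ^ n) := ((p ^ (n - c) : ℕ) : ZMod (p ^ n)) with ht
  set ψ : ZMod (p ^ c) → ℂ_[p] := fun y ↦ χ (1 + t * ((y.val : ℕ) : ZMod (p ^ n))) with hψdef
  have hψ : ∀ y : ZMod (p ^ c), ψ y = χ (1 + t * ((y.val : ℕ) : ZMod (p ^ n))) := fun y ↦ rfl
  -- the reduced unit `ū = u mod p^c`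
  set ub : (ZMod (p ^ c))ˣ := Units.map (π : ZMod (p ^ n) →* ZMod (p ^ c)) u with hub
  have hub_val : (ub : ZMod (p ^ c)) = π u := rfl
  have hub_inv : π ((u⁻¹ : (ZMod (p ^ n))ˣ) : ZMod (p ^ n)) = ((ub⁻¹ : (ZMod (p ^ c))ˣ) : ZMod (p ^ c)) := rfl
  -- each term: `χ(u − t b) = χ u · ψ(−b ū⁻¹)`
  have hterm : ∀ b : ZMod (p ^ c),
      χ ((u : ZMod (p ^ n)) - t * ((b.val : ℕ) : ZMod (p ^ n))) = χ u * ψ (-(b * (ub⁻¹ : (ZMod (p ^ c))ˣ))) := by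
    intro b
    set y : ZMod (p ^ c) := -(b * (ub⁻¹ : (ZMod (p ^ c))ˣ)) with hy
    have hlift : t * ((y.val : ℕ) : ZMod (p ^ n)) =
        -(t * (((b.val : ℕ) : ZMod (p ^ n)) * (u⁻¹ : (ZMod (p ^ n))ˣ))) := by
      rw [← mul_neg]
      refine mul_eq_mul_of_castHom_eq hcn ?_
      rw [castHom_natCast_val hcn, map_neg, map_mul, castHom_natCast_val hcn, hub_inv, hy]
    have hu : (u : ZMod (p ^ n)) * (u⁻¹ : (ZMod (p ^ n))ˣ) = 1 := Units.mul_inv u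
    have hfac : (u : ZMod (p ^ n)) - t * ((b.val : ℕ) : ZMod (p ^ n)) =
        u * (1 + t * ((y.val : ℕ) : ZMod (p ^ n))) := by
      linear_combination (-(u : ZMod (p ^ n))) * hlift + (t * ((b.val : ℕ) : ZMod (p ^ n))) * hu
    rw [hfac, map_mul, hψ y]
  simp_rw [hterm]
  -- re-index `b ↦ −ū·b'`
  have hre : ∑ b : ZMod (p ^ c), η b * (χ u * ψ (-(b * (ub⁻¹ : (ZMod (p ^ c))ˣ)))) =
      ∑ b' : ZMod (p ^ c), η (-(ub : ZMod (p ^ c)) * b') * (χ u * ψ b') := by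
    refine Fintype.sum_equiv (Units.mulLeft (-ub⁻¹)) _ _ fun b ↦ ?_
    simp only [Units.mulLeft_apply, Units.val_neg]
    congr 2
    · rw [← mul_assoc, neg_mul_neg, Units.mul_inv, one_mul]
    · rw [neg_mul, mul_comm]
  rw [hre]
  have hsplit : ∀ b' : ZMod (p ^ c), η (-(ub : ZMod (p ^ c)) * b') * (χ u * ψ b') =
      (χ u * η (-1) * η (ub : ZMod (p ^ c))) * (η b' * ψ b') := by
    intro b'
    rw [show -(ub : ZMod (p ^ c)) * b' = (-1) * (ub : ZMod (p ^ c)) * b' by ring, map_mul, map_mul]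
    ring
  simp_rw [hsplit, ← Finset.mul_sum]
  show _ = χ u * η (-1) * η (π u) * ∑ b : ZMod (p ^ c), η b * ψ b
  rw [hub_val]

/-- **THE UNTWISTING IDENTITY AT EVERY LEVEL `n > c`.** For a prime `p`, `c < n`, Dirichlet characters
`η` mod `p^c`, `χ` mod `pⁿ` (values in `ℂ_p`) and any cusp form `f` on `Γ₀(N)`:
`untwistSymbolSum p f η χ = η(−1) · J_n(η,χ) · ratTwistedSymbolSum f (χ · η↑)`,
`J_n(η,χ) = ∑_{b mod p^c} η(b) χ(1 + p^{n−c} b)`. [cite: MazurTateTeitelbaum1986Invent, §I.8 (8.6) and §I.14 (case p ∣ N)] -/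
theorem untwistSymbolSum_eq_charSum (hcn : c < n) :
    untwistSymbolSum p f η χ =
      η (-1) * (∑ b : ZMod (p ^ c), η b * χ (1 + ((p ^ (n - c) : ℕ) : ZMod (p ^ n)) * ((b.val : ℕ) : ZMod (p ^ n)))) *
        ratTwistedSymbolSum f (χ * changeLevel (pow_dvd_pow p hcn.le) η) := by
  have hcn' : c ≤ n := hcn.le
  haveI : NeZero (p ^ n) := ⟨pow_ne_zero _ (Fact.out : p.Prime).ne_zero⟩
  haveI : NeZero (p ^ c) := ⟨pow_ne_zero _ (Fact.out : p.Prime).ne_zero⟩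
  set t : ZMod (p ^ n) := ((p ^ (n - c) : ℕ) : ZMod (p ^ n)) with ht
  set A : ZMod (p ^ n) → ℂ_[p] := fun x ↦ algebraMap ℚ ℂ_[p] (ratPlusSymbol f ((x.val : ℚ) / (p : ℚ) ^ n))
    with hA
  have h1 : untwistSymbolSum p f η χ =
      ∑ a : ZMod (p ^ n), ∑ b : ZMod (p ^ c), χ a * η b * A (a + t * ((b.val : ℕ) : ZMod (p ^ n))) := by
    unfold untwistSymbolSum
    refine Finset.sum_congr rfl fun a _ ↦ Finset.sum_congr rfl fun b _ ↦ ?_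
    rw [ratPlusSymbol_double_eq f hcn' a b]
  have h2 : ∑ a : ZMod (p ^ n), ∑ b : ZMod (p ^ c), χ a * η b * A (a + t * ((b.val : ℕ) : ZMod (p ^ n))) =
      ∑ a' : ZMod (p ^ n), A a' *
        ∑ b : ZMod (p ^ c), η b * χ (a' - t * ((b.val : ℕ) : ZMod (p ^ n))) := by
    rw [Finset.sum_comm]
    have hre : ∀ b : ZMod (p ^ c),
        ∑ a : ZMod (p ^ n), χ a * η b * A (a + t * ((b.val : ℕ) : ZMod (p ^ n))) =
          ∑ a' : ZMod (p ^ n), χ (a' - t * ((b.val : ℕ) : ZMod (p ^ n))) * η b * A a' := fun b ↦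
      Fintype.sum_equiv (Equiv.addRight (t * ((b.val : ℕ) : ZMod (p ^ n)))) _ _ fun a ↦ by
        simp only [Equiv.coe_addRight, add_sub_cancel_right]
    rw [Finset.sum_congr rfl fun b _ ↦ hre b, Finset.sum_comm]
    refine Finset.sum_congr rfl fun a' _ ↦ ?_
    rw [Finset.mul_sum]
    exact Finset.sum_congr rfl fun b _ ↦ by ring
  rw [h1, h2, ratTwistedSymbolSum, Finset.mul_sum]
  refine Finset.sum_congr rfl fun a' _ ↦ ?_
  have hAa : (ratPlusSymbol f ((a'.val : ℚ) / ((p ^ n : ℕ) : ℚ)) : ℂ_[p]) = A a' := by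
    simp only [hA, eq_ratCast, Nat.cast_pow]
  rw [hAa, MulChar.mul_apply]
  by_cases ha : IsUnit a'
  · obtain ⟨u, rfl⟩ := ha
    rw [inner_sum_eq_charSum_of_isUnit η χ hcn' u, changeLevel_eq_cast_of_dvd η (pow_dvd_pow p hcn'),
      ZMod.castHom_apply]
    ring
  · rw [inner_sum_eq_zero_of_not_isUnit η χ hcn ha, χ.map_nonunit ha]
    ring

/-- For `2c ≤ n` the character sum IS the Gauss sum of (★): `J_n(η, χ) = g(η, ψ_χ)` for the additive
`ψ_χ(y) = χ(1 + p^{n−c}y)` (`PSUntwisting.exists_addChar_eq`). [folklore] -/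
theorem charSum_eq_gaussSum (ψ : AddChar (ZMod (p ^ c)) ℂ_[p])
    (hψ : ∀ y : ZMod (p ^ c), ψ y = χ (1 + ((p ^ (n - c) : ℕ) : ZMod (p ^ n)) * ((y.val : ℕ) : ZMod (p ^ n)))) :
    ∑ b : ZMod (p ^ c), η b * χ (1 + ((p ^ (n - c) : ℕ) : ZMod (p ^ n)) * ((b.val : ℕ) : ZMod (p ^ n))) =
      gaussSum η ψ := by
  rw [gaussSum]
  exact Finset.sum_congr rfl fun b _ ↦ by rw [hψ]

end Identity

/-! ### Consequence for D1 at every conductor `pⁿ > p^c` -/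

section Interpolation

variable {N : ℕ} [NeZero N] {f : CuspForm (Gamma0 N) 2}
variable {c : ℕ} {η : DirichletCharacter ℂ_[p] (p ^ c)} {α : ℂ_[p]} {μ : (n : ℕ) → ZMod (p ^ n) → ℂ_[p]}

/-- **D1's interpolation value at EVERY conductor `pⁿ > p^c`** (`c ≥ 1`): for `μ` with
`IsUntwistedPAdicLFunction p f η α μ`, `ξ` primitive even of `p`-power order mod `pⁿ` (`n > c`), `χ`
primitive mod `pⁿ` agreeing with `η⁻¹ξ` off `p`:
`∫_Γ ξ dμ = e_n(α) · η(−1) · J_n(η, χ) · ∑_{a mod pⁿ} ξ(a) [a/pⁿ]⁺_f`. On the route this covers conductor `27`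
(`n = 3`), the one level between `9` and `81`. [cite: MazurTateTeitelbaum1986Invent, §I.14 (case p ∣ N)] -/
theorem gammaCharValue_eq_charSum (hμ : IsUntwistedPAdicLFunction p f η α μ) (hc : 0 < c)
    {n : ℕ} (hcn : c < n) (ξ : DirichletCharacter ℂ_[p] (p ^ n)) (hξ : ξ.IsPrimitive) (hξe : ξ.Even)
    (hξo : ∃ j : ℕ, orderOf ξ = p ^ j) (χ : DirichletCharacter ℂ_[p] (p ^ n)) (hχ : χ.IsPrimitive)
    (hcompat : ∀ a : ℕ, a.Coprime p → χ (a : ZMod (p ^ n)) = (η (a : ZMod (p ^ c)))⁻¹ * ξ (a : ZMod (p ^ n))) :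
    gammaCharValue p μ ξ = untwistMultiplier p α n *
      (η (-1) * (∑ b : ZMod (p ^ c), η b * χ (1 + ((p ^ (n - c) : ℕ) : ZMod (p ^ n)) * ((b.val : ℕ) : ZMod (p ^ n)))) *
        ratTwistedSymbolSum f ξ) := by
  obtain ⟨-, -, hint⟩ := hμ
  rw [hint n ξ hξ hξe hξo n χ hχ hcompat, untwistSymbolSum_eq_charSum f η χ hcn,
    mul_changeLevel_eq_of_compat hc hcn.le χ ξ hcompat]

end Interpolation

end Summit.BirchSwinnertonDyer.BirchSwinnertonDyer.Theorems.PSUntwistingAll
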